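import Summits.ResolutionOfSingularities.ResolutionOfSingularities.Theorems.FrobeniusLadderFInjectiveMacaulayficationHWeightedData
import Mathlib.RingTheory.MvPolynomial.WeightedHomogeneous
import Mathlib.Algebra.MvPolynomial.PDeriv
import Mathlib.Algebra.MvPolynomial.Equiv
import Mathlib.Algebra.Polynomial.Degree.Domain
import Mathlib.RingTheory.Polynomial.UniqueFactorization
import HarnessLib

/-!
# idea-1's control threefold point `f = z² + (y² + x³)³ + x¹⁰ + w⁵` as a `(10,15,45,18)`-FILTERED specimen: characteristic-free data
# (crux `FInjectiveMacaulayfication`, line `graded-engine` §17 filtered engine, calibration G6h = idea-1 matrix row 13)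

Support file for crux stmt-ResolutionOfSingularities-15315 (`FrobeniusLadder.FInjectiveMacaulayfication`), chain w45a,
seat res-L1-w45a-stub-3. [OURS · L1 W4.5a; idea-1 r2 TEST MATRIX row 13 («g + w⁵, p = 7, control, isolated at 0»)] — NOT a
statement of the manuscript; AI-written, weaker than expert review.

`f = X₂² + (X₁² + X₀³)³ + X₀¹⁰ + X₃⁵` (`X₀ = x, X₁ = y, X₂ = z, X₃ = w`) is semi-quasi-homogeneous for `w = (10, 15, 45, 18)` with initial
form `F₀ = X₂² + (X₁² + X₀³)³ + X₃⁵` (weight `90`; the tail `X₀¹⁰` has weight `100`) whose singular locus is the cuspidal CURVE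
`{X₂ = X₃ = 0, X₁² + X₀³ = 0}` — a non-linear stratum, handled at `p = 7` in the companion file `…G5wClauses` by the generic
certificate `FedderViaSlicing.clause_of_sliceCoeff`. This file: the characteristic-free specimen data for the filtered engine G5♮
(`N = 90`, `c = (9, 6, 2, 5)`, `D = 90`; saturation `G5wVeronese`):

* `F0_isWeightedHomogeneous` (weight `90`), `tail_isWeightedHomogeneous` (`X₀¹⁰`, weight `100`), and the INITIAL-FORM facts
  `weightedHomogeneousComponent_ninety` (`= F₀`), `weightedHomogeneousComponent_lt_ninety` (`= 0`), `F0_ne_zero`;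
* `prime_g5w` — `f` is prime over EVERY field and divides no variable (`T² + c`, `c(0, 0, T) = T⁵` of odd degree:
  `HWeightedData.mul_self_ne_neg_of_odd_natDegree`), `span_g5w_isPrime`, `g5w_X_ne_zero`;
* the partial derivatives of `F₀` and `f` (`∂₀F₀ = 9X₀²φ²`, `∂₀f = 9X₀²φ² + 10X₀⁹`, `∂₁ = 6X₁φ²`, `∂₂ = 2X₂`, `∂₃ = 5X₃⁴`, `φ = X₁² + X₀³`)
  and the two IDENTITIES `jacobian_identity` / `cubic_identity` used to show that `V(f)` is an isolated singularity at `p = 7`.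

All proofs are glue on Mathlib and landed files; no definitions, no named facts. [folklore]
-/

-- single-problem summit: the doubled namespace component is forced
set_option linter.dupNamespace false

noncomputable section

namespace Summit.ResolutionOfSingularities.ResolutionOfSingularities.Theorems.FInjectiveMacaulayfication.G5wData

open MvPolynomial
open Summit.ResolutionOfSingularities.ResolutionOfSingularities.Theorems.FInjectiveMacaulayfication

/-! ## Weighted homogeneity and the initial form -/

/-- `F₀ = X₂² + (X₁² + X₀³)³ + X₃⁵` is `(10,15,45,18)`-weighted-homogeneous of weight `90`. [folklore] -/
theorem F0_isWeightedHomogeneous (k : Type) [Field k] :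
    MvPolynomial.IsWeightedHomogeneous (![10, 15, 45, 18] : Fin 4 → ℕ)
      (X 2 ^ 2 + (X 1 ^ 2 + X 0 ^ 3) ^ 3 + X 3 ^ 5 : MvPolynomial (Fin 4) k) 90 := by
  have hX := fun j : Fin 4 => isWeightedHomogeneous_X k (![10, 15, 45, 18] : Fin 4 → ℕ) j
  have hφ : IsWeightedHomogeneous (![10, 15, 45, 18] : Fin 4 → ℕ) (X 1 ^ 2 + X 0 ^ 3 : MvPolynomial (Fin 4) k) 30 := by
    refine IsWeightedHomogeneous.add ?_ ?_
    · simpa using (hX 1).pow 2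
    · simpa using (hX 0).pow 3
  refine ((?_ : IsWeightedHomogeneous _ _ 90).add ?_).add ?_
  · simpa using (hX 2).pow 2
  · simpa using hφ.pow 3
  · simpa using (hX 3).pow 5

/-- The tail `X₀¹⁰` is `(10,15,45,18)`-weighted-homogeneous of weight `100`. [folklore] -/
theorem tail_isWeightedHomogeneous (k : Type) [Field k] :
    MvPolynomial.IsWeightedHomogeneous (![10, 15, 45, 18] : Fin 4 → ℕ) (X 0 ^ 10 : MvPolynomial (Fin 4) k) 100 := by
  simpa using (isWeightedHomogeneous_X k (![10, 15, 45, 18] : Fin 4 → ℕ) 0).pow 10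

/-- **The `(10,15,45,18)`-weight-`90` component of `f` is `F₀`.** [folklore] -/
theorem weightedHomogeneousComponent_ninety (k : Type) [Field k] (f : MvPolynomial (Fin 4) k)
    (hf : f = X 2 ^ 2 + (X 1 ^ 2 + X 0 ^ 3) ^ 3 + X 0 ^ 10 + X 3 ^ 5) :
    MvPolynomial.weightedHomogeneousComponent (![10, 15, 45, 18] : Fin 4 → ℕ) 90 f =
      X 2 ^ 2 + (X 1 ^ 2 + X 0 ^ 3) ^ 3 + X 3 ^ 5 := by
  have e : f = (X 2 ^ 2 + (X 1 ^ 2 + X 0 ^ 3) ^ 3 + X 3 ^ 5) + X 0 ^ 10 := by rw [hf]; ring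
  rw [e, map_add, (F0_isWeightedHomogeneous k).weightedHomogeneousComponent_same,
    (tail_isWeightedHomogeneous k).weightedHomogeneousComponent_ne 90 (by norm_num), add_zero]

/-- **`f` has `(10,15,45,18)`-order `90`**: all weighted-homogeneous components below `90` vanish. [folklore] -/
theorem weightedHomogeneousComponent_lt_ninety (k : Type) [Field k] (f : MvPolynomial (Fin 4) k)
    (hf : f = X 2 ^ 2 + (X 1 ^ 2 + X 0 ^ 3) ^ 3 + X 0 ^ 10 + X 3 ^ 5) :
    ∀ m < 90, MvPolynomial.weightedHomogeneousComponent (![10, 15, 45, 18] : Fin 4 → ℕ) m f = 0 := by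
  intro m hm
  have e : f = (X 2 ^ 2 + (X 1 ^ 2 + X 0 ^ 3) ^ 3 + X 3 ^ 5) + X 0 ^ 10 := by rw [hf]; ring
  rw [e, map_add, (F0_isWeightedHomogeneous k).weightedHomogeneousComponent_ne m (by omega),
    (tail_isWeightedHomogeneous k).weightedHomogeneousComponent_ne m (by omega), add_zero]

/-- `F₀ ≠ 0` (it takes the value `1` at `(0,0,1,0)`). [folklore] -/
theorem F0_ne_zero (k : Type) [Field k] :
    (X 2 ^ 2 + (X 1 ^ 2 + X 0 ^ 3) ^ 3 + X 3 ^ 5 : MvPolynomial (Fin 4) k) ≠ 0 := by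
  intro h0
  have h1 := congrArg (MvPolynomial.eval ![(0 : k), 0, 1, 0]) h0
  simp at h1

/-! ## Primality over every field -/

/-- **`f = X₂² + (X₁² + X₀³)³ + X₀¹⁰ + X₃⁵` is prime over every field and divides no variable** (`k[X₀,…,X₃] ≃ k[Y₀,Y₁,Y₂][T]`,
`X₂ ↦ T`, `X₀ ↦ C Y₁`, `X₁ ↦ C Y₀`, `X₃ ↦ C Y₂`; `f ↦ T² + c`, `c(0,0,T) = T⁵` has odd degree). [folklore] -/
theorem prime_g5w (k : Type) [Field k] (f : MvPolynomial (Fin 4) k)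
    (hf : f = X 2 ^ 2 + (X 1 ^ 2 + X 0 ^ 3) ^ 3 + X 0 ^ 10 + X 3 ^ 5) :
    Prime f ∧ ∀ v : Fin 4, ¬ f ∣ MvPolynomial.X v := by
  obtain ⟨e, he0, he1, he2, he3⟩ : ∃ e : MvPolynomial (Fin 4) k ≃+* Polynomial (MvPolynomial (Fin 3) k),
      e (X 0) = Polynomial.C (X 1) ∧ e (X 1) = Polynomial.C (X 0) ∧ e (X 2) = Polynomial.X ∧
        e (X 3) = Polynomial.C (X 2) := by
    refine ⟨((renameEquiv k (Equiv.swap (0 : Fin 4) 2)).trans (finSuccEquiv k 3)).toRingEquiv, ?_, ?_, ?_, ?_⟩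
    · show finSuccEquiv k 3 (rename (Equiv.swap (0 : Fin 4) 2) (X 0)) = _
      rw [rename_X, Equiv.swap_apply_left]
      exact finSuccEquiv_X_succ (j := 1)
    · show finSuccEquiv k 3 (rename (Equiv.swap (0 : Fin 4) 2) (X 1)) = _
      rw [rename_X, Equiv.swap_apply_of_ne_of_ne (by decide) (by decide)]
      exact finSuccEquiv_X_succ (j := 0)
    · show finSuccEquiv k 3 (rename (Equiv.swap (0 : Fin 4) 2) (X 2)) = _
      rw [rename_X, Equiv.swap_apply_right]
      exact finSuccEquiv_X_zero
    · show finSuccEquiv k 3 (rename (Equiv.swap (0 : Fin 4) 2) (X 3)) = _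
      rw [rename_X, Equiv.swap_apply_of_ne_of_ne (by decide) (by decide)]
      exact finSuccEquiv_X_succ (j := 2)
  have hef : e f = Polynomial.X ^ 2 +
      Polynomial.C ((X 0 ^ 2 + X 1 ^ 3) ^ 3 + X 1 ^ 10 + X 2 ^ 5 : MvPolynomial (Fin 3) k) := by
    subst hf
    simp only [map_add, map_pow, he0, he1, he2, he3]
    ring
  have hc : ∀ a : MvPolynomial (Fin 3) k, a * a ≠ -((X 0 ^ 2 + X 1 ^ 3) ^ 3 + X 1 ^ 10 + X 2 ^ 5) := by
    refine HWeightedData.mul_self_ne_neg_of_odd_natDegree ![0, 0, Polynomial.X] ?_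
    have hv : MvPolynomial.aeval (![0, 0, Polynomial.X] : Fin 3 → Polynomial k)
        ((X 0 ^ 2 + X 1 ^ 3) ^ 3 + X 1 ^ 10 + X 2 ^ 5 : MvPolynomial (Fin 3) k) = Polynomial.X ^ 5 := by
      simp only [map_add, map_pow, MvPolynomial.aeval_X, Matrix.cons_val_zero, Matrix.cons_val_one, Matrix.cons_val]
      norm_num
    rw [hv, Polynomial.natDegree_X_pow]
    decide
  obtain ⟨hp, hnd⟩ := E8Forms.prime_and_not_dvd_of_ringEquiv e f _ hef hc
  refine ⟨hp, fun v => ?_⟩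
  fin_cases v
  · exact hnd (X 0) (X 1) (X_ne_zero 1) he0
  · exact hnd (X 1) (X 0) (X_ne_zero 0) he1
  · rintro ⟨q, hq⟩
    have h1 : (Polynomial.X ^ 2 + Polynomial.C ((X 0 ^ 2 + X 1 ^ 3) ^ 3 + X 1 ^ 10 + X 2 ^ 5) :
        Polynomial (MvPolynomial (Fin 3) k)) ∣ Polynomial.X :=
      ⟨e q, by rw [← hef, ← map_mul, ← hq]; exact he2.symm⟩
    have h2 := Polynomial.natDegree_le_of_dvd h1 Polynomial.X_ne_zero
    rw [Polynomial.natDegree_X_pow_add_C, Polynomial.natDegree_X] at h2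
    omega
  · exact hnd (X 3) (X 2) (X_ne_zero 2) he3

/-- `(f)` is a prime ideal. [folklore] -/
theorem span_g5w_isPrime (k : Type) [Field k] (f : MvPolynomial (Fin 4) k)
    (hf : f = X 2 ^ 2 + (X 1 ^ 2 + X 0 ^ 3) ^ 3 + X 0 ^ 10 + X 3 ^ 5) : (Ideal.span {f}).IsPrime :=
  (Ideal.span_singleton_prime (prime_g5w k f hf).1.ne_zero).mpr (prime_g5w k f hf).1

/-- No variable lies in `(f)`. [folklore] -/
theorem g5w_X_ne_zero (k : Type) [Field k] (f : MvPolynomial (Fin 4) k)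
    (hf : f = X 2 ^ 2 + (X 1 ^ 2 + X 0 ^ 3) ^ 3 + X 0 ^ 10 + X 3 ^ 5) (v : Fin 4) :
    Ideal.Quotient.mk (Ideal.span {f}) (MvPolynomial.X v) ≠ 0 := fun h0 =>
  (prime_g5w k f hf).2 v (Ideal.mem_span_singleton.mp (Ideal.Quotient.eq_zero_iff_mem.mp h0))

/-! ## Partial derivatives and identities -/

/-- `∂₀ F₀ = 9X₀²(X₁² + X₀³)²`. [folklore] -/
theorem pderiv_zero_F0 {A : Type*} [CommRing A] :
    pderiv 0 (X 2 ^ 2 + (X 1 ^ 2 + X 0 ^ 3) ^ 3 + X 3 ^ 5 : MvPolynomial (Fin 4) A) =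
      9 * X 0 ^ 2 * (X 1 ^ 2 + X 0 ^ 3) ^ 2 := by
  simp only [map_add, pderiv_pow, pderiv_X_self,
    pderiv_X_of_ne (show (1 : Fin 4) ≠ 0 by decide), pderiv_X_of_ne (show (2 : Fin 4) ≠ 0 by decide),
    pderiv_X_of_ne (show (3 : Fin 4) ≠ 0 by decide)]
  norm_num
  ring

/-- `∂₀ f = 9X₀²(X₁² + X₀³)² + 10X₀⁹`. [folklore] -/
theorem pderiv_zero_g5w {A : Type*} [CommRing A] :
    pderiv 0 (X 2 ^ 2 + (X 1 ^ 2 + X 0 ^ 3) ^ 3 + X 0 ^ 10 + X 3 ^ 5 : MvPolynomial (Fin 4) A) =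
      9 * X 0 ^ 2 * (X 1 ^ 2 + X 0 ^ 3) ^ 2 + 10 * X 0 ^ 9 := by
  simp only [map_add, pderiv_pow, pderiv_X_self,
    pderiv_X_of_ne (show (1 : Fin 4) ≠ 0 by decide), pderiv_X_of_ne (show (2 : Fin 4) ≠ 0 by decide),
    pderiv_X_of_ne (show (3 : Fin 4) ≠ 0 by decide)]
  norm_num
  ring

/-- `∂₁` of `F₀` and of `f`: `6X₁(X₁² + X₀³)²` (the tail `X₀¹⁰` does not involve `X₁`). [folklore] -/
theorem pderiv_one_g5w {A : Type*} [CommRing A] (t : ℕ) :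
    pderiv 1 (X 2 ^ 2 + (X 1 ^ 2 + X 0 ^ 3) ^ 3 + t • X 0 ^ 10 + X 3 ^ 5 : MvPolynomial (Fin 4) A) =
      6 * X 1 * (X 1 ^ 2 + X 0 ^ 3) ^ 2 := by
  simp only [map_add, map_nsmul, pderiv_pow, pderiv_X_self,
    pderiv_X_of_ne (show (0 : Fin 4) ≠ 1 by decide), pderiv_X_of_ne (show (2 : Fin 4) ≠ 1 by decide),
    pderiv_X_of_ne (show (3 : Fin 4) ≠ 1 by decide)]
  norm_num
  ring

/-- `∂₂` of `F₀` and of `f`: `2X₂`. [folklore] -/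
theorem pderiv_two_g5w {A : Type*} [CommRing A] (t : ℕ) :
    pderiv 2 (X 2 ^ 2 + (X 1 ^ 2 + X 0 ^ 3) ^ 3 + t • X 0 ^ 10 + X 3 ^ 5 : MvPolynomial (Fin 4) A) = 2 * X 2 := by
  simp only [map_add, map_nsmul, pderiv_pow, pderiv_X_self,
    pderiv_X_of_ne (show (0 : Fin 4) ≠ 2 by decide), pderiv_X_of_ne (show (1 : Fin 4) ≠ 2 by decide),
    pderiv_X_of_ne (show (3 : Fin 4) ≠ 2 by decide)]
  norm_num

/-- `∂₃` of `F₀` and of `f`: `5X₃⁴`. [folklore] -/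
theorem pderiv_three_g5w {A : Type*} [CommRing A] (t : ℕ) :
    pderiv 3 (X 2 ^ 2 + (X 1 ^ 2 + X 0 ^ 3) ^ 3 + t • X 0 ^ 10 + X 3 ^ 5 : MvPolynomial (Fin 4) A) = 5 * X 3 ^ 4 := by
  simp only [map_add, map_nsmul, pderiv_pow, pderiv_X_self,
    pderiv_X_of_ne (show (0 : Fin 4) ≠ 3 by decide), pderiv_X_of_ne (show (1 : Fin 4) ≠ 3 by decide),
    pderiv_X_of_ne (show (2 : Fin 4) ≠ 3 by decide)]
  norm_num

/-- **Jacobian identity**: with `φ = X₁² + X₀³`, `∂₀f − 9X₀²X₁²(φ + X₀³) = 9X₀⁸ + 10X₀⁹`. [folklore] -/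
theorem jacobian_identity {A : Type*} [CommRing A] (x y : A) :
    9 * x ^ 2 * (y ^ 2 + x ^ 3) ^ 2 + 10 * x ^ 9 - 9 * x ^ 2 * y ^ 2 * ((y ^ 2 + x ^ 3) + x ^ 3) =
      x ^ 8 * (9 + 10 * x) := by
  ring

/-- **Cubic identity**: `φ³ + X₀¹⁰ − X₁²(φ² + φX₀³ + X₀⁶) = X₀⁹(1 + X₀)`. [folklore] -/
theorem cubic_identity {A : Type*} [CommRing A] (x y : A) :
    (y ^ 2 + x ^ 3) ^ 3 + x ^ 10 - y ^ 2 * ((y ^ 2 + x ^ 3) ^ 2 + (y ^ 2 + x ^ 3) * x ^ 3 + x ^ 6) =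
      x ^ 9 * (1 + x) := by
  ring

end Summit.ResolutionOfSingularities.ResolutionOfSingularities.Theorems.FInjectiveMacaulayfication.G5wData

end
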